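import Literature.AlgebraicGeometry.Deformation.SmoothSchemeLiftObstructionFunctorialCechRestrict
import Literature.AlgebraicGeometry.Deformation.SmoothSchemeLiftObstructionFunctorialCechForms
import Literature.AlgebraicGeometry.Morphisms.CechModuleUnit
import HarnessLib

/-!
# Čech bookkeeping of the functoriality of the obstruction class: `f^*[o^X] − M·[o^Y]` is a coboundary, per global `1`-form
# (Hartshorne, *Deformation Theory*, proof of Thm. 10.2; Illusie: «the obstruction is functorial»; Oort 1971 §2.2)

Layer `Literature/AlgebraicGeometry/Deformation`, namespace `Literature.AlgebraicGeometry.Deformation` (THEOREMS only).  Head of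
the three-file story (★ `…FunctorialCechRestrict`: restricted chart lifts, pair data; ★ `…FunctorialCechForms`: the identity on
`1`-forms, the pull-back term, readings commute with restriction), in the currency of ★ F2 `…CechCocycleIdentity.exists_obstructionCochain`
(principal affine cover `U_j ∩ U_l = D(b j l)`, principal small extension `J ≅ k`, gluing automorphisms `ψ ≡ 1 (mod 𝔫')`,
obstruction cochain `o ∈ Č²(𝔘, 𝒯)` REPRESENTING the discrepancies) for BOTH sides of `f : Y → X` over `Spec k` (`U′_j = f⁻¹U_j`),
chart lifts `F_j ≡ 1 ⊗ f♯ (mod 𝔫')` intertwining the gluing data modulo `J`, and a global `1`-form `ω` on `X` with `f^*ω = M·ω′`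
(case of record: `f = [n]` on an abelian scheme, `ω` invariant, `M = n`):
**`exists_cechMD1_eq_comap_obstruction_sub` — `∃ ε ∈ Č¹(U′, 𝒪_Y)`, `f♯((o^X jlm)(ω|)) − M·(o^Y jlm)(ω′|) = (d¹ε)_{jlm}`**, with
`ε_{jl} = ℓ_{jl}(ω|)` the `1`-form reading of the defect coordinate of `(F_j, F_l)`: the `ω`-component of `f^*[o^X] = df_*[o^Y]`
in `Ȟ²` (letter of the cell's `SOCKET-iv1b-FILE-B2.v0`, closed `by exact`).  Per triple: restrict automorphisms and the six chart
lifts to `U_jlm` (★ `exists_algEquiv_restrict`, `exists_algHom_restrict₂`, `algHom_restrict_restrict_eq`), transport the mod-`J`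
intertwining (★ `sub_mem_restrict_of_forall`), take defect coordinates and readings there (★ `exists_defectCoord`,
`exists_semilinear_lift_of_leibniz`), apply ★ `semilinear_obstruction_functorial_rep`, compute the pull-back term from
`f^*ω = M·ω′` (★ `semilinear_lift_eq_comap`), descend the readings (★ `defectReading_restrict`); `d¹` of `𝒪_Y`-as-a-module is
the structure-sheaf `d¹` (★ `cechMD1_unit`).

Cell `hodgecm-mathlib` (D-0151), F-11 α1 / J4-(iv) road (a′) brick (iv-1b) FILE B2 (B-p08 (g16); F0P1b-plan (R34); F0P1b-p05 FIT LIST slot (3)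
rel₁).  HC_CM is proved only modulo the 7 printed citations until rung 0 closes — nothing here bears on a summit statement.

## References
* [Hartshorne2010] R. Hartshorne, *Deformation Theory*, GTM 257, Springer (2010): Thm. 10.2 (a) and its proof (p. 81),
  Remark 10.1.1 (p. 80), Cor. 10.3 (p. 82).
* [Hartshorne1977] R. Hartshorne, *Algebraic Geometry* (1977): II.8 p. 172, II Remark 8.9.2 (p. 175), III §4 p. 218.
* (prose only) L. Illusie, in *FGA Explained*, AMS (2005), §8.5; F. Oort, Compositio Math. 23 (1971), §2.2.
-/

noncomputable section

-- `TopCat.Presheaf`/`Scheme.Modules` are not reducible (as in ★ F2 `SmoothSchemeLiftObstructionCechCocycle`).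
set_option backward.isDefEq.respectTransparency false

open CategoryTheory AlgebraicGeometry Opposite TopologicalSpace
open scoped TensorProduct

universe u

namespace Literature.AlgebraicGeometry.Deformation

open Literature.AlgebraicGeometry.HodgeTheory Literature.AlgebraicGeometry.Modules
  Literature.AlgebraicGeometry.Motives Literature.AlgebraicGeometry.Morphisms SmoothAffineDeformation

variable {k : Type u} [Field k] {X Y : Over (Spec (CommRingCat.of k))}
  [instΓX : ∀ W : X.left.Opens, Algebra k Γ(X.left, W)] [instΓY : ∀ W : Y.left.Opens, Algebra k Γ(Y.left, W)]
  (halgX : ∀ (W : X.left.Opens) (s : k), algebraMap k Γ(X.left, W) s = (constToPresheaf X).app (op W) s)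
  (halgY : ∀ (W : Y.left.Opens) (s : k), algebraMap k Γ(Y.left, W) s = (constToPresheaf Y).app (op W) s)
  (f : Y ⟶ X)

variable {A' : Type u} [CommRing A'] [Algebra k A']

/-! ## The head: `f^*[o^X] − M·[o^Y]` is a Čech coboundary, componentwise on a global `1`-form -/

section Head

variable (J 𝔫' : Ideal A') (hJ : J * J = ⊥) (hJ𝔫 : J * 𝔫' = ⊥) (h𝔫 : IsNilpotent 𝔫')
  (e : ↥(J.restrictScalars k) ≃ₗ[k] k)
  {ι : Type u} (U : ι → X.left.affineOpens) (b : (j l : ι) → Γ(X.left, (U j).1))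
  (hb : ∀ j l, (U j).1 ⊓ (U l).1 = X.left.basicOpen (b j l))
  (U' : ι → Y.left.affineOpens) (hU' : ∀ j, (U' j).1 = f.left ⁻¹ᵁ (U j).1)

set_option maxHeartbeats 400000 in -- one long bookkeeping proof (≈ 60 local facts on a triple overlap)
include halgX halgY hJ hJ𝔫 h𝔫 hb hU' in
/-- **ČECH FUNCTORIALITY OF THE OBSTRUCTION CLASS, per global `1`-form** (letter of the cell's `SOCKET-iv1b-FILE-B2.v0`).
For lifted gluing data `ψ^X` (cover `U`) and `ψ^Y` (cover `U′ = f⁻¹U`) with obstruction cochains `o^X`, `o^Y` (★ F2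
`exists_obstructionCochain`), chart lifts `F_j` of `f♯` reducing to `1 ⊗ f♯` modulo `𝔫'` and intertwining the two data modulo
`J` on the overlaps, and global `1`-forms `ω` (on `X`), `ω′` (on `Y`) with `f^*ω = M·ω′`:
**`∃ ε ∈ Č¹(U′, 𝒪_Y)` with `f♯((o^X jlm)(ω|)) − M·(o^Y jlm)(ω′|) = (d¹ε)_{jlm}` for all `j l m`** — with `ε_{jl} = ℓ_{jl}(ω|)` the
`1`-form reading of the defect coordinate of the pair `(F_j, F_l)` (★ `exists_pairData`).  Per triple: ★
`semilinear_obstruction_functorial_rep` on `U_jlm` with the restricted data (★ `exists_algEquiv_restrict`,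
`exists_algHom_restrict₂`), the pull-back term by ★ `semilinear_lift_eq_comap` and `f^*ω = M·ω′`, and «defect readings commute
with restriction» (★ `defectReading_restrict`). [cite: Hartshorne2010, Thm. 10.2 (proof), p. 81] [cite: Hartshorne2010, Cor. 10.3, p. 82] -/
theorem exists_cechMD1_eq_comap_obstruction_sub
    (ψX : (j l : ι) → A' ⊗[k] Γ(X.left, (U j).1 ⊓ (U l).1) ≃ₐ[A'] A' ⊗[k] Γ(X.left, (U j).1 ⊓ (U l).1))
    (hψX : ∀ j l x, ψX j l x - x ∈ 𝔫' • (⊤ : Submodule A' (A' ⊗[k] Γ(X.left, (U j).1 ⊓ (U l).1))))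
    (ψY : (j l : ι) → A' ⊗[k] Γ(Y.left, (U' j).1 ⊓ (U' l).1) ≃ₐ[A'] A' ⊗[k] Γ(Y.left, (U' j).1 ⊓ (U' l).1))
    (hψY : ∀ j l x, ψY j l x - x ∈ 𝔫' • (⊤ : Submodule A' (A' ⊗[k] Γ(Y.left, (U' j).1 ⊓ (U' l).1))))
    (oX : CechMC2 X.hom (tangentSheaf X) (fun j => (U j).1))
    (hoX : ∀ (j l m : ι)
      (Φjl : A' ⊗[k] Γ(X.left, (U j).1 ⊓ (U l).1) →ₐ[A'] A' ⊗[k] Γ(X.left, (U j).1 ⊓ (U l).1 ⊓ (U m).1))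
      (_ : ∀ a s, Φjl (a ⊗ₜ s) = a ⊗ₜ X.left.presheaf.map (homOfLE inf_le_left).op s)
      (Φlm : A' ⊗[k] Γ(X.left, (U l).1 ⊓ (U m).1) →ₐ[A'] A' ⊗[k] Γ(X.left, (U j).1 ⊓ (U l).1 ⊓ (U m).1))
      (_ : ∀ a s, Φlm (a ⊗ₜ s) = a ⊗ₜ X.left.presheaf.map
        (homOfLE (le_inf (inf_le_left.trans inf_le_right) inf_le_right)).op s)
      (Φjm : A' ⊗[k] Γ(X.left, (U j).1 ⊓ (U m).1) →ₐ[A'] A' ⊗[k] Γ(X.left, (U j).1 ⊓ (U l).1 ⊓ (U m).1))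
      (_ : ∀ a s, Φjm (a ⊗ₜ s) = a ⊗ₜ X.left.presheaf.map
        (homOfLE (le_inf (inf_le_left.trans inf_le_left) inf_le_right)).op s)
      (ρjl ρlm ρjm : A' ⊗[k] Γ(X.left, (U j).1 ⊓ (U l).1 ⊓ (U m).1) ≃ₐ[A']
        A' ⊗[k] Γ(X.left, (U j).1 ⊓ (U l).1 ⊓ (U m).1)),
      (∀ x, ρjl (Φjl x) = Φjl (ψX j l x)) → (∀ x, ρlm (Φlm x) = Φlm (ψX l m x)) →
      (∀ x, ρjm (Φjm x) = Φjm (ψX j m x)) →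
      ∀ c : Γ(X.left, (U j).1 ⊓ (U l).1 ⊓ (U m).1), (ρlm * ρjl * ρjm⁻¹) ((1 : A') ⊗ₜ c) =
        (1 : A') ⊗ₜ c + ((e.symm 1 : ↥(J.restrictScalars k)) : A') ⊗ₜ
          (show Γ(X.left, (U j).1 ⊓ (U l).1 ⊓ (U m).1) from appLE (oX j l m) (𝟙 _) (dSection X _ c)))
    (oY : CechMC2 Y.hom (tangentSheaf Y) (fun j => (U' j).1))
    (hoY : ∀ (j l m : ι)
      (Φjl : A' ⊗[k] Γ(Y.left, (U' j).1 ⊓ (U' l).1) →ₐ[A'] A' ⊗[k] Γ(Y.left, (U' j).1 ⊓ (U' l).1 ⊓ (U' m).1))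
      (_ : ∀ a s, Φjl (a ⊗ₜ s) = a ⊗ₜ Y.left.presheaf.map (homOfLE inf_le_left).op s)
      (Φlm : A' ⊗[k] Γ(Y.left, (U' l).1 ⊓ (U' m).1) →ₐ[A'] A' ⊗[k] Γ(Y.left, (U' j).1 ⊓ (U' l).1 ⊓ (U' m).1))
      (_ : ∀ a s, Φlm (a ⊗ₜ s) = a ⊗ₜ Y.left.presheaf.map
        (homOfLE (le_inf (inf_le_left.trans inf_le_right) inf_le_right)).op s)
      (Φjm : A' ⊗[k] Γ(Y.left, (U' j).1 ⊓ (U' m).1) →ₐ[A'] A' ⊗[k] Γ(Y.left, (U' j).1 ⊓ (U' l).1 ⊓ (U' m).1))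
      (_ : ∀ a s, Φjm (a ⊗ₜ s) = a ⊗ₜ Y.left.presheaf.map
        (homOfLE (le_inf (inf_le_left.trans inf_le_left) inf_le_right)).op s)
      (ρjl ρlm ρjm : A' ⊗[k] Γ(Y.left, (U' j).1 ⊓ (U' l).1 ⊓ (U' m).1) ≃ₐ[A']
        A' ⊗[k] Γ(Y.left, (U' j).1 ⊓ (U' l).1 ⊓ (U' m).1)),
      (∀ x, ρjl (Φjl x) = Φjl (ψY j l x)) → (∀ x, ρlm (Φlm x) = Φlm (ψY l m x)) →
      (∀ x, ρjm (Φjm x) = Φjm (ψY j m x)) →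
      ∀ c : Γ(Y.left, (U' j).1 ⊓ (U' l).1 ⊓ (U' m).1), (ρlm * ρjl * ρjm⁻¹) ((1 : A') ⊗ₜ c) =
        (1 : A') ⊗ₜ c + ((e.symm 1 : ↥(J.restrictScalars k)) : A') ⊗ₜ
          (show Γ(Y.left, (U' j).1 ⊓ (U' l).1 ⊓ (U' m).1) from appLE (oY j l m) (𝟙 _) (dSection Y _ c)))
    (F : (j : ι) → A' ⊗[k] Γ(X.left, (U j).1) →ₐ[A'] A' ⊗[k] Γ(Y.left, (U' j).1))
    (hF : ∀ j (c : Γ(X.left, (U j).1)),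
      F j ((1 : A') ⊗ₜ c) - (1 : A') ⊗ₜ f.left.appLE (U j).1 (U' j).1 (hU' j).le c ∈
        𝔫' • (⊤ : Submodule A' (A' ⊗[k] Γ(Y.left, (U' j).1))))
    (hFψ : ∀ (j l : ι)
      (ΦXj : A' ⊗[k] Γ(X.left, (U j).1) →ₐ[A'] A' ⊗[k] Γ(X.left, (U j).1 ⊓ (U l).1))
      (_ : ∀ a s, ΦXj (a ⊗ₜ s) = a ⊗ₜ X.left.presheaf.map (homOfLE inf_le_left).op s)
      (ΦXl : A' ⊗[k] Γ(X.left, (U l).1) →ₐ[A'] A' ⊗[k] Γ(X.left, (U j).1 ⊓ (U l).1))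
      (_ : ∀ a s, ΦXl (a ⊗ₜ s) = a ⊗ₜ X.left.presheaf.map (homOfLE inf_le_right).op s)
      (ΦYj : A' ⊗[k] Γ(Y.left, (U' j).1) →ₐ[A'] A' ⊗[k] Γ(Y.left, (U' j).1 ⊓ (U' l).1))
      (_ : ∀ a s, ΦYj (a ⊗ₜ s) = a ⊗ₜ Y.left.presheaf.map (homOfLE inf_le_left).op s)
      (ΦYl : A' ⊗[k] Γ(Y.left, (U' l).1) →ₐ[A'] A' ⊗[k] Γ(Y.left, (U' j).1 ⊓ (U' l).1))
      (_ : ∀ a s, ΦYl (a ⊗ₜ s) = a ⊗ₜ Y.left.presheaf.map (homOfLE inf_le_right).op s)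
      (Fj Fl : A' ⊗[k] Γ(X.left, (U j).1 ⊓ (U l).1) →ₐ[A'] A' ⊗[k] Γ(Y.left, (U' j).1 ⊓ (U' l).1)),
      (∀ x, Fj (ΦXj x) = ΦYj (F j x)) → (∀ x, Fl (ΦXl x) = ΦYl (F l x)) →
      ∀ c : Γ(X.left, (U j).1 ⊓ (U l).1),
        Fl (ψX j l ((1 : A') ⊗ₜ c)) - ψY j l (Fj ((1 : A') ⊗ₜ c)) ∈
          J • (⊤ : Submodule A' (A' ⊗[k] Γ(Y.left, (U' j).1 ⊓ (U' l).1))))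
    (ω : Γ(cotangentSheaf X, ⊤)) (ω' : Γ(cotangentSheaf Y, ⊤)) (M : k)
    (hω : (cotangentSheaf.comap f).app ⊤ ω =
      (show Γ(cotangentSheaf Y, ⊤) from algebraMap k Γ(Y.left, ⊤) M • ω')) :
    ∃ ε : CechMC1 Y.hom (unitModule Y.left) (fun j => (U' j).1), ∀ j l m : ι,
      f.left.appLE ((U j).1 ⊓ (U l).1 ⊓ (U m).1) ((U' j).1 ⊓ (U' l).1 ⊓ (U' m).1)
          (inf₃_le_preimage f U U' hU' j l m)
          (show Γ(X.left, (U j).1 ⊓ (U l).1 ⊓ (U m).1) from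
            appLE (oX j l m) (𝟙 _) ((cotangentSheaf X).presheaf.map (homOfLE le_top).op ω)) -
        algebraMap k Γ(Y.left, (U' j).1 ⊓ (U' l).1 ⊓ (U' m).1) M *
          (show Γ(Y.left, (U' j).1 ⊓ (U' l).1 ⊓ (U' m).1) from
            appLE (oY j l m) (𝟙 _) ((cotangentSheaf Y).presheaf.map (homOfLE le_top).op ω')) =
      (show Γ(Y.left, (U' j).1 ⊓ (U' l).1 ⊓ (U' m).1) from cechMD1 Y.hom (unitModule Y.left) (fun j => (U' j).1) ε j l m) := by
  classical
  have hb' := inf_eq_basicOpen_appLE f U b hb U' hU'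
  have hP := fun j l => exists_pairData halgX halgY f J 𝔫' hJ hJ𝔫 h𝔫 e U b hb U' hU' ψX ψY hψY F hF hFψ j l
  choose ΦXa ΦXb ΦYa ΦYb Fp Fq δ ℓ hΦXa hΦXb hΦYa hΦYb hFpΦ hFqΦ hFp hFq hδ hδadd hδmul hδconst hℓ hℓd using hP
  refine ⟨fun j l => (show Γ(unitModule Y.left, (U' j).1 ⊓ (U' l).1) from
    ℓ j l ((cotangentSheaf X).presheaf.map (homOfLE le_top).op ω)), fun j l m => ?_⟩
  /- ### The triple overlap `W = U_jlm`, `W' = U'_jlm` -/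
  have h3 := inf₃_le_preimage f U U' hU' j l m
  have hWaff : IsAffineOpen ((U j).1 ⊓ (U l).1 ⊓ (U m).1) := isAffineOpen_inf₃ U b hb j l m
  let g₃ : Γ(X.left, (U j).1 ⊓ (U l).1 ⊓ (U m).1) →ₐ[k] Γ(Y.left, (U' j).1 ⊓ (U' l).1 ⊓ (U' m).1) :=
    { (f.left.appLE _ _ h3).hom with commutes' := fun c => appLE_algebraMap_eq_algebraMap halgX halgY f h3 c }
  have hg₃ : ∀ c, g₃ c = f.left.appLE _ _ h3 c := fun _ => rfl
  -- principal-open equations for `W` inside the three pair overlaps and the three charts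
  have eWjl : (U j).1 ⊓ (U l).1 ⊓ (U m).1 =
      X.left.basicOpen (X.left.presheaf.map (homOfLE (inf_le_left : (U j).1 ⊓ (U l).1 ≤ (U j).1)).op (b j m)) :=
    inf_eq_basicOpen_map U b hb inf_le_left m
  have eWlm : (U j).1 ⊓ (U l).1 ⊓ (U m).1 =
      X.left.basicOpen (X.left.presheaf.map (homOfLE (inf_le_left : (U l).1 ⊓ (U m).1 ≤ (U l).1)).op (b l j)) := by
    rw [← inf_eq_basicOpen_map U b hb inf_le_left j]; ac_rfl
  have eWjm : (U j).1 ⊓ (U l).1 ⊓ (U m).1 =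
      X.left.basicOpen (X.left.presheaf.map (homOfLE (inf_le_left : (U j).1 ⊓ (U m).1 ≤ (U j).1)).op (b j l)) := by
    rw [← inf_eq_basicOpen_map U b hb inf_le_left l]; ac_rfl
  have eWj : (U j).1 ⊓ (U l).1 ⊓ (U m).1 = X.left.basicOpen
      (X.left.presheaf.map (homOfLE (le_rfl : (U j).1 ≤ (U j).1)).op (b j l) *
        X.left.presheaf.map (homOfLE (le_rfl : (U j).1 ≤ (U j).1)).op (b j m)) := by
    rw [← inf_inf_eq_basicOpen_map U b hb le_rfl l m]
  have eWl : (U j).1 ⊓ (U l).1 ⊓ (U m).1 = X.left.basicOpen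
      (X.left.presheaf.map (homOfLE (le_rfl : (U l).1 ≤ (U l).1)).op (b l j) *
        X.left.presheaf.map (homOfLE (le_rfl : (U l).1 ≤ (U l).1)).op (b l m)) := by
    rw [← inf_inf_eq_basicOpen_map U b hb le_rfl j m]; ac_rfl
  have eWm : (U j).1 ⊓ (U l).1 ⊓ (U m).1 = X.left.basicOpen
      (X.left.presheaf.map (homOfLE (le_rfl : (U m).1 ≤ (U m).1)).op (b m j) *
        X.left.presheaf.map (homOfLE (le_rfl : (U m).1 ≤ (U m).1)).op (b m l)) := by
    rw [← inf_inf_eq_basicOpen_map U b hb le_rfl j l]; ac_rfl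
  -- the same on `Y` for the principal cover `U' = f⁻¹U`, `b' = f♯ b`
  have eW'jl : (U' j).1 ⊓ (U' l).1 ⊓ (U' m).1 =
      Y.left.basicOpen (Y.left.presheaf.map (homOfLE (inf_le_left : (U' j).1 ⊓ (U' l).1 ≤ (U' j).1)).op
        (f.left.appLE (U j).1 (U' j).1 (hU' j).le (b j m))) :=
    inf_eq_basicOpen_map U' _ hb' inf_le_left m
  have eW'lm : (U' j).1 ⊓ (U' l).1 ⊓ (U' m).1 =
      Y.left.basicOpen (Y.left.presheaf.map (homOfLE (inf_le_left : (U' l).1 ⊓ (U' m).1 ≤ (U' l).1)).op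
        (f.left.appLE (U l).1 (U' l).1 (hU' l).le (b l j))) := by
    rw [← inf_eq_basicOpen_map U' _ hb' inf_le_left j]; ac_rfl
  have eW'jm : (U' j).1 ⊓ (U' l).1 ⊓ (U' m).1 =
      Y.left.basicOpen (Y.left.presheaf.map (homOfLE (inf_le_left : (U' j).1 ⊓ (U' m).1 ≤ (U' j).1)).op
        (f.left.appLE (U j).1 (U' j).1 (hU' j).le (b j l))) := by
    rw [← inf_eq_basicOpen_map U' _ hb' inf_le_left l]; ac_rfl
  -- `W' = D(f♯(b_{pr}|_{U_pq}))` (the form ★ `exists_algHom_restrict₂` wants)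
  have rb : ∀ p q r : ι, Y.left.presheaf.map (homOfLE (inf_le_left : (U' p).1 ⊓ (U' q).1 ≤ (U' p).1)).op
        (f.left.appLE (U p).1 (U' p).1 (hU' p).le (b p r)) =
      f.left.appLE ((U p).1 ⊓ (U q).1) ((U' p).1 ⊓ (U' q).1) (inf₂_le_preimage f U U' hU' p q)
        (X.left.presheaf.map (homOfLE (inf_le_left : (U p).1 ⊓ (U q).1 ≤ (U p).1)).op (b p r)) := fun p q r => by
    rw [← CommRingCat.comp_apply, Scheme.Hom.appLE_map, ← CommRingCat.comp_apply, Scheme.Hom.map_appLE]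
  rw [rb j l m] at eW'jl; rw [rb l m j] at eW'lm; rw [rb j m l] at eW'jm
  have lWjl : (U j).1 ⊓ (U l).1 ⊓ (U m).1 ≤ (U j).1 ⊓ (U l).1 := inf_le_left
  have lWlm : (U j).1 ⊓ (U l).1 ⊓ (U m).1 ≤ (U l).1 ⊓ (U m).1 := le_inf (inf_le_left.trans inf_le_right) inf_le_right
  have lWjm : (U j).1 ⊓ (U l).1 ⊓ (U m).1 ≤ (U j).1 ⊓ (U m).1 := le_inf (inf_le_left.trans inf_le_left) inf_le_right
  have lW'jl : (U' j).1 ⊓ (U' l).1 ⊓ (U' m).1 ≤ (U' j).1 ⊓ (U' l).1 := inf_le_left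
  have lW'lm : (U' j).1 ⊓ (U' l).1 ⊓ (U' m).1 ≤ (U' l).1 ⊓ (U' m).1 := le_inf (inf_le_left.trans inf_le_right) inf_le_right
  have lW'jm : (U' j).1 ⊓ (U' l).1 ⊓ (U' m).1 ≤ (U' j).1 ⊓ (U' m).1 := le_inf (inf_le_left.trans inf_le_left) inf_le_right
  /- ### Base-change maps to the triple overlap and the restricted gluing automorphisms -/
  obtain ⟨ΦXjl, hΦXjl⟩ := exists_baseChangeMap (A' := A') halgX ((U j).1 ⊓ (U l).1) ((U j).1 ⊓ (U l).1 ⊓ (U m).1) lWjl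
  obtain ⟨ΦXlm, hΦXlm⟩ := exists_baseChangeMap (A' := A') halgX ((U l).1 ⊓ (U m).1) ((U j).1 ⊓ (U l).1 ⊓ (U m).1) lWlm
  obtain ⟨ΦXjm, hΦXjm⟩ := exists_baseChangeMap (A' := A') halgX ((U j).1 ⊓ (U m).1) ((U j).1 ⊓ (U l).1 ⊓ (U m).1) lWjm
  obtain ⟨ΦYjl, hΦYjl⟩ := exists_baseChangeMap (A' := A') halgY ((U' j).1 ⊓ (U' l).1)
    ((U' j).1 ⊓ (U' l).1 ⊓ (U' m).1) lW'jl
  obtain ⟨ΦYlm, hΦYlm⟩ := exists_baseChangeMap (A' := A') halgY ((U' l).1 ⊓ (U' m).1)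
    ((U' j).1 ⊓ (U' l).1 ⊓ (U' m).1) lW'lm
  obtain ⟨ΦYjm, hΦYjm⟩ := exists_baseChangeMap (A' := A') halgY ((U' j).1 ⊓ (U' m).1)
    ((U' j).1 ⊓ (U' l).1 ⊓ (U' m).1) lW'jm
  obtain ⟨ρXjl, hρXjlc, hρXjl𝔫⟩ := exists_algEquiv_restrict halgX 𝔫' (isAffineOpen_inf₂ U b hb j l) _ eWjl lWjl h𝔫
    (ψX j l) (hψX j l) hΦXjl
  obtain ⟨ρXlm, hρXlmc, hρXlm𝔫⟩ := exists_algEquiv_restrict halgX 𝔫' (isAffineOpen_inf₂ U b hb l m) _ eWlm lWlm h𝔫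
    (ψX l m) (hψX l m) hΦXlm
  obtain ⟨ρXjm, hρXjmc, hρXjm𝔫⟩ := exists_algEquiv_restrict halgX 𝔫' (isAffineOpen_inf₂ U b hb j m) _ eWjm lWjm h𝔫
    (ψX j m) (hψX j m) hΦXjm
  obtain ⟨ρYjl, hρYjlc, hρYjl𝔫⟩ := exists_algEquiv_restrict halgY 𝔫' (isAffineOpen_inf₂ U' _ hb' j l) _ eW'jl lW'jl
    h𝔫 (ψY j l) (hψY j l) hΦYjl
  obtain ⟨ρYlm, hρYlmc, hρYlm𝔫⟩ := exists_algEquiv_restrict halgY 𝔫' (isAffineOpen_inf₂ U' _ hb' l m) _ eW'lm lW'lm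
    h𝔫 (ψY l m) (hψY l m) hΦYlm
  obtain ⟨ρYjm, hρYjmc, hρYjm𝔫⟩ := exists_algEquiv_restrict halgY 𝔫' (isAffineOpen_inf₂ U' _ hb' j m) _ eW'jm lW'jm
    h𝔫 (ψY j m) (hψY j m) hΦYjm
  /- ### The six restricted chart lifts on the triple overlap -/
  obtain ⟨Tj, hTjΦ, hTj𝔫⟩ := exists_algHom_restrict₂ halgX halgY f 𝔫' (isAffineOpen_inf₂ U b hb j l) _ eWjl lWjl
    (isAffineOpen_inf₂ U' _ hb' j l) (inf₂_le_preimage f U U' hU' j l) eW'jl lW'jl h3 h𝔫 (Fp j l) (hFp j l) hΦXjl hΦYjl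
  obtain ⟨Tl, hTlΦ, hTl𝔫⟩ := exists_algHom_restrict₂ halgX halgY f 𝔫' (isAffineOpen_inf₂ U b hb j l) _ eWjl lWjl
    (isAffineOpen_inf₂ U' _ hb' j l) (inf₂_le_preimage f U U' hU' j l) eW'jl lW'jl h3 h𝔫 (Fq j l) (hFq j l) hΦXjl hΦYjl
  obtain ⟨Tl', hTl'Φ, hTl'𝔫⟩ := exists_algHom_restrict₂ halgX halgY f 𝔫' (isAffineOpen_inf₂ U b hb l m) _ eWlm lWlm
    (isAffineOpen_inf₂ U' _ hb' l m) (inf₂_le_preimage f U U' hU' l m) eW'lm lW'lm h3 h𝔫 (Fp l m) (hFp l m) hΦXlm hΦYlm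
  obtain ⟨Tm, hTmΦ, hTm𝔫⟩ := exists_algHom_restrict₂ halgX halgY f 𝔫' (isAffineOpen_inf₂ U b hb l m) _ eWlm lWlm
    (isAffineOpen_inf₂ U' _ hb' l m) (inf₂_le_preimage f U U' hU' l m) eW'lm lW'lm h3 h𝔫 (Fq l m) (hFq l m) hΦXlm hΦYlm
  obtain ⟨Tj', hTj'Φ, hTj'𝔫⟩ := exists_algHom_restrict₂ halgX halgY f 𝔫' (isAffineOpen_inf₂ U b hb j m) _ eWjm lWjm
    (isAffineOpen_inf₂ U' _ hb' j m) (inf₂_le_preimage f U U' hU' j m) eW'jm lW'jm h3 h𝔫 (Fp j m) (hFp j m) hΦXjm hΦYjm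
  obtain ⟨Tm', hTm'Φ, hTm'𝔫⟩ := exists_algHom_restrict₂ halgX halgY f 𝔫' (isAffineOpen_inf₂ U b hb j m) _ eWjm lWjm
    (isAffineOpen_inf₂ U' _ hb' j m) (inf₂_le_preimage f U U' hU' j m) eW'jm lW'jm h3 h𝔫 (Fq j m) (hFq j m) hΦXjm hΦYjm
  have iTl : ∀ y, Tl' y = Tl y := fun y =>
    algHom_restrict_restrict_eq halgX halgY (U l).2 _ eWl (inf_le_left.trans inf_le_right) inf_le_left inf_le_right
      lWlm lWjl (V' := (U' l).1) inf_le_left inf_le_right lW'lm lW'jl (F l) (hΦXa l m) (hΦXb j l) hΦXlm hΦXjl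
      (hΦYa l m) (hΦYb j l) hΦYlm hΦYjl (hFpΦ l m) (hFqΦ j l) hTl'Φ hTlΦ y
  have iTj : ∀ y, Tj' y = Tj y := fun y =>
    algHom_restrict_restrict_eq halgX halgY (U j).2 _ eWj (inf_le_left.trans inf_le_left) inf_le_left inf_le_left
      lWjm lWjl (V' := (U' j).1) inf_le_left inf_le_left lW'jm lW'jl (F j) (hΦXa j m) (hΦXa j l) hΦXjm hΦXjl
      (hΦYa j m) (hΦYa j l) hΦYjm hΦYjl (hFpΦ j m) (hFpΦ j l) hTj'Φ hTjΦ y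
  have iTm : ∀ y, Tm' y = Tm y := fun y =>
    algHom_restrict_restrict_eq halgX halgY (U m).2 _ eWm inf_le_right inf_le_right inf_le_right
      lWjm lWlm (V' := (U' m).1) inf_le_right inf_le_right lW'jm lW'lm (F m) (hΦXb j m) (hΦXb l m) hΦXjm hΦXlm
      (hΦYb j m) (hΦYb l m) hΦYjm hΦYlm (hFqΦ j m) (hFqΦ l m) hTm'Φ hTmΦ y
  /- ### The pairs are intertwined modulo `J` on the triple overlap -/
  have hcJ : ∀ (p q : ι) (c : Γ(X.left, (U p).1 ⊓ (U q).1)),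
      Fq p q (ψX p q ((1 : A') ⊗ₜ c)) - ψY p q (Fp p q ((1 : A') ⊗ₜ c)) ∈
        J • (⊤ : Submodule A' (A' ⊗[k] Γ(Y.left, (U' p).1 ⊓ (U' q).1))) := fun p q c => by
    rw [hδ p q c, add_sub_cancel_left, ← idealTensorIncl_tmul]
    exact idealTensorIncl_mem J _
  have PQjl : ∀ x, Tl (ρXjl (ΦXjl x)) - ρYjl (Tj (ΦXjl x)) ∈
      J • (⊤ : Submodule A' (A' ⊗[k] Γ(Y.left, (U' j).1 ⊓ (U' l).1 ⊓ (U' m).1))) := fun x => by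
    rw [hρXjlc, hTlΦ, hTjΦ, hρYjlc]
    have hx := algHom_map_mem_smul_top J ΦYjl (defect₂_mem_smul_top J (Fp j l) (Fq j l) (ψX j l) (ψY j l) (hcJ j l) x)
    rwa [map_sub] at hx
  have PQlm : ∀ x, Tm (ρXlm (ΦXlm x)) - ρYlm (Tl' (ΦXlm x)) ∈
      J • (⊤ : Submodule A' (A' ⊗[k] Γ(Y.left, (U' j).1 ⊓ (U' l).1 ⊓ (U' m).1))) := fun x => by
    rw [hρXlmc, hTmΦ, hTl'Φ, hρYlmc]
    have hx := algHom_map_mem_smul_top J ΦYlm (defect₂_mem_smul_top J (Fp l m) (Fq l m) (ψX l m) (ψY l m) (hcJ l m) x)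
    rwa [map_sub] at hx
  have PQjm : ∀ x, Tm' (ρXjm (ΦXjm x)) - ρYjm (Tj' (ΦXjm x)) ∈
      J • (⊤ : Submodule A' (A' ⊗[k] Γ(Y.left, (U' j).1 ⊓ (U' l).1 ⊓ (U' m).1))) := fun x => by
    rw [hρXjmc, hTm'Φ, hTj'Φ, hρYjmc]
    have hx := algHom_map_mem_smul_top J ΦYjm (defect₂_mem_smul_top J (Fp j m) (Fq j m) (ψX j m) (ψY j m) (hcJ j m) x)
    rwa [map_sub] at hx
  have Rjl : ∀ y, Tl (ρXjl y) - ρYjl (Tj y) ∈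
      J • (⊤ : Submodule A' (A' ⊗[k] Γ(Y.left, (U' j).1 ⊓ (U' l).1 ⊓ (U' m).1))) := fun y =>
    sub_mem_restrict_of_forall halgX (isAffineOpen_inf₂ U b hb j l) _ eWjl lWjl J hΦXjl
      (Tl.comp ρXjl.toAlgHom) (ρYjl.toAlgHom.comp Tj) PQjl y
  have Rlm : ∀ y, Tm (ρXlm y) - ρYlm (Tl' y) ∈
      J • (⊤ : Submodule A' (A' ⊗[k] Γ(Y.left, (U' j).1 ⊓ (U' l).1 ⊓ (U' m).1))) := fun y =>
    sub_mem_restrict_of_forall halgX (isAffineOpen_inf₂ U b hb l m) _ eWlm lWlm J hΦXlm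
      (Tm.comp ρXlm.toAlgHom) (ρYlm.toAlgHom.comp Tl') PQlm y
  have Rjm : ∀ y, Tm' (ρXjm y) - ρYjm (Tj' y) ∈
      J • (⊤ : Submodule A' (A' ⊗[k] Γ(Y.left, (U' j).1 ⊓ (U' l).1 ⊓ (U' m).1))) := fun y =>
    sub_mem_restrict_of_forall halgX (isAffineOpen_inf₂ U b hb j m) _ eWjm lWjm J hΦXjm
      (Tm'.comp ρXjm.toAlgHom) (ρYjm.toAlgHom.comp Tj') PQjm y
  /- ### Defect coordinates on the triple overlap and their `1`-form readings -/
  obtain ⟨δ₁, hδ₁, hδ₁add, hδ₁mul, hδ₁const⟩ := exists_defectCoord halgX J hJ hJ𝔫 e g₃ Tj Tl hTj𝔫 ρXjl ρYjl hρYjl𝔫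
    (fun c => Rjl _)
  obtain ⟨δ₂, hδ₂, hδ₂add, hδ₂mul, hδ₂const⟩ := exists_defectCoord halgX J hJ hJ𝔫 e g₃ Tl' Tm hTl'𝔫 ρXlm ρYlm hρYlm𝔫
    (fun c => Rlm _)
  obtain ⟨δ₃, hδ₃, hδ₃add, hδ₃mul, hδ₃const⟩ := exists_defectCoord halgX J hJ hJ𝔫 e g₃ Tj' Tm' hTj'𝔫 ρXjm ρYjm hρYjm𝔫
    (fun c => Rjm _)
  obtain ⟨ℓ₁, hℓ₁, hℓ₁d⟩ := exists_semilinear_lift_of_leibniz (f.left.appLE _ _ h3).hom hWaff δ₁ hδ₁add hδ₁mul hδ₁const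
  obtain ⟨ℓ₂, hℓ₂, hℓ₂d⟩ := exists_semilinear_lift_of_leibniz (f.left.appLE _ _ h3).hom hWaff δ₂ hδ₂add hδ₂mul hδ₂const
  obtain ⟨ℓ₃, hℓ₃, hℓ₃d⟩ := exists_semilinear_lift_of_leibniz (f.left.appLE _ _ h3).hom hWaff δ₃ hδ₃add hδ₃mul hδ₃const
  obtain ⟨ℓY, hℓY, hℓYd⟩ := exists_semilinear_lift_of_leibniz (f.left.appLE _ _ h3).hom hWaff
    (fun c => show Γ(Y.left, (U' j).1 ⊓ (U' l).1 ⊓ (U' m).1) from appLE (oY j l m) (𝟙 _) (dSection Y _ (g₃ c)))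
    (fun a c => by
      change appLE (oY j l m) (𝟙 _) (dSection Y _ (g₃ (a + c))) =
        appLE (oY j l m) (𝟙 _) (dSection Y _ (g₃ a)) + appLE (oY j l m) (𝟙 _) (dSection Y _ (g₃ c))
      rw [map_add, HodgeTheory.appLE_dSection_add])
    (fun a c => by
      change (show Γ(Y.left, _) from appLE (oY j l m) (𝟙 _) (dSection Y _ (g₃ (a * c)))) =
        g₃ a * (show Γ(Y.left, _) from appLE (oY j l m) (𝟙 _) (dSection Y _ (g₃ c))) +
          g₃ c * (show Γ(Y.left, _) from appLE (oY j l m) (𝟙 _) (dSection Y _ (g₃ a)))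
      rw [map_mul]
      exact HodgeTheory.appLE_dSection_mul' (oY j l m) (g₃ a) (g₃ c))
    (fun s => by
      change appLE (oY j l m) (𝟙 _) (dSection Y _ (g₃ ((constToPresheaf X).app (op _) s))) = 0
      rw [hg₃, appLE_constToPresheaf f _ _ h3 s]
      exact HodgeTheory.appLE_dSection_constToPresheaf_app (oY j l m) s)
  /- ### The identity on `1`-forms on the triple overlap -/
  have E := semilinear_obstruction_functorial_rep halgX J hJ hJ𝔫 e g₃ hWaff ρXjl ρXlm ρXjm ρYjl ρYlm ρYjm
    hρXjl𝔫 hρXjm𝔫 hρYjl𝔫 hρYlm𝔫 hρYjm𝔫 (oX j l m)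
    (hoX j l m ΦXjl hΦXjl ΦXlm hΦXlm ΦXjm hΦXjm ρXjl ρXlm ρXjm hρXjlc hρXlmc hρXjmc) (oY j l m)
    (hoY j l m ΦYjl hΦYjl ΦYlm hΦYlm ΦYjm hΦYjm ρYjl ρYlm ρYjm hρYjlc hρYlmc hρYjmc) Tj Tl Tm hTm𝔫 δ₁ δ₂ δ₃ hδ₁
    (fun c => by rw [← iTl]; exact hδ₂ c) (fun c => by rw [← iTm, ← iTj]; exact hδ₃ c)
    hδ₁add hδ₁mul hδ₁const hδ₂add hδ₂mul hδ₂const hδ₃add hδ₃mul hδ₃const ℓY ℓ₁ ℓ₂ ℓ₃ hℓY hℓYd hℓ₁ hℓ₁d hℓ₂ hℓ₂d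
    hℓ₃ hℓ₃d ((cotangentSheaf X).presheaf.map (homOfLE le_top).op ω)
  /- ### (e1) the pull-back term is `M · o^Y(ω'|)` -/
  have hnat : (cotangentSheaf.comap f).app ((U j).1 ⊓ (U l).1 ⊓ (U m).1)
      ((cotangentSheaf X).presheaf.map (homOfLE (le_top : (U j).1 ⊓ (U l).1 ⊓ (U m).1 ≤ ⊤)).op ω) =
      (pushforwardCotangentSheaf f).presheaf.map (homOfLE (le_top : (U j).1 ⊓ (U l).1 ⊓ (U m).1 ≤ ⊤)).op
        ((cotangentSheaf.comap f).app ⊤ ω) := by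
    have := ConcreteCategory.congr_hom
      ((cotangentSheaf.comap f).mapPresheaf.naturality (homOfLE (le_top : (U j).1 ⊓ (U l).1 ⊓ (U m).1 ≤ ⊤)).op) ω
    simpa only [ConcreteCategory.comp_apply, Scheme.Modules.mapPresheaf_app] using this
  have hpull : (cotangentSheaf Y).presheaf.map (homOfLE h3).op ((cotangentSheaf.comap f).app ((U j).1 ⊓ (U l).1 ⊓ (U m).1)
      ((cotangentSheaf X).presheaf.map (homOfLE (le_top : (U j).1 ⊓ (U l).1 ⊓ (U m).1 ≤ ⊤)).op ω)) =
      algebraMap k Γ(Y.left, (U' j).1 ⊓ (U' l).1 ⊓ (U' m).1) M •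
        (cotangentSheaf Y).presheaf.map (homOfLE (le_top : (U' j).1 ⊓ (U' l).1 ⊓ (U' m).1 ≤ ⊤)).op ω' := by
    rw [hnat]
    change (cotangentSheaf Y).presheaf.map (homOfLE h3).op ((cotangentSheaf Y).presheaf.map
      ((Opens.map f.left.base).map (homOfLE (le_top : (U j).1 ⊓ (U l).1 ⊓ (U m).1 ≤ ⊤))).op
        ((cotangentSheaf.comap f).app ⊤ ω)) = _
    rw [← ConcreteCategory.comp_apply, ← Functor.map_comp]
    change (cotangentSheaf Y).presheaf.map (homOfLE (le_top : (U' j).1 ⊓ (U' l).1 ⊓ (U' m).1 ≤ ⊤)).op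
      (show Γ(cotangentSheaf Y, ⊤) from (cotangentSheaf.comap f).app ⊤ ω) = _
    rw [hω]
    change (cotangentSheaf Y).presheaf.map (homOfLE (le_top : (U' j).1 ⊓ (U' l).1 ⊓ (U' m).1 ≤ ⊤)).op
      (algebraMap k Γ(Y.left, ⊤) M • ω') = _
    rw [Scheme.Modules.map_smul, halgY, halgY, map_constToPresheaf_app_of_le]
  have hY : ℓY ((cotangentSheaf X).presheaf.map (homOfLE le_top).op ω) =
      algebraMap k Γ(Y.left, (U' j).1 ⊓ (U' l).1 ⊓ (U' m).1) M *
        (show Γ(Y.left, (U' j).1 ⊓ (U' l).1 ⊓ (U' m).1) from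
          appLE (oY j l m) (𝟙 _) ((cotangentSheaf Y).presheaf.map (homOfLE le_top).op ω')) := by
    rw [semilinear_lift_eq_comap f hWaff h3 (oY j l m) ℓY hℓY hℓYd, hpull, appLE_smul_right]
    rfl
  /- ### (e2) defect readings commute with restriction -/
  have resω : ∀ {V : X.left.Opens} (hV : (U j).1 ⊓ (U l).1 ⊓ (U m).1 ≤ V),
      (cotangentSheaf X).presheaf.map (homOfLE hV).op ((cotangentSheaf X).presheaf.map (homOfLE (le_top : V ≤ ⊤)).op ω) =
        (cotangentSheaf X).presheaf.map (homOfLE le_top).op ω := fun hV => by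
    rw [← ConcreteCategory.comp_apply, ← Functor.map_comp]; rfl
  have hε₁ := defectReading_restrict f J e (isAffineOpen_inf₂ U b hb j l) lWjl lW'jl (inf₂_le_preimage f U U' hU' j l) h3
    hΦXjl hΦYjl (Fp j l) (Fq j l) (ψX j l) (ψY j l) (δ j l) (hδ j l) (ℓ j l) (hℓ j l) (hℓd j l) Tj Tl hTjΦ hTlΦ ρXjl hρXjlc
    ρYjl hρYjlc δ₁ hδ₁ ℓ₁ hℓ₁ hℓ₁d ((cotangentSheaf X).presheaf.map (homOfLE le_top).op ω)
  have hε₂ := defectReading_restrict f J e (isAffineOpen_inf₂ U b hb l m) lWlm lW'lm (inf₂_le_preimage f U U' hU' l m) h3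
    hΦXlm hΦYlm (Fp l m) (Fq l m) (ψX l m) (ψY l m) (δ l m) (hδ l m) (ℓ l m) (hℓ l m) (hℓd l m) Tl' Tm hTl'Φ hTmΦ ρXlm
    hρXlmc ρYlm hρYlmc δ₂ hδ₂ ℓ₂ hℓ₂ hℓ₂d ((cotangentSheaf X).presheaf.map (homOfLE le_top).op ω)
  have hε₃ := defectReading_restrict f J e (isAffineOpen_inf₂ U b hb j m) lWjm lW'jm (inf₂_le_preimage f U U' hU' j m) h3
    hΦXjm hΦYjm (Fp j m) (Fq j m) (ψX j m) (ψY j m) (δ j m) (hδ j m) (ℓ j m) (hℓ j m) (hℓd j m) Tj' Tm' hTj'Φ hTm'Φ ρXjm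
    hρXjmc ρYjm hρYjmc δ₃ hδ₃ ℓ₃ hℓ₃ hℓ₃d ((cotangentSheaf X).presheaf.map (homOfLE le_top).op ω)
  -- transport along `(ω|_{U_ab})|_W = ω|_W` by `congrArg` (no `rw`: matching under `Ω¹` is expensive)
  replace hε₁ := (congrArg ℓ₁ (resω lWjl)).symm.trans hε₁
  replace hε₂ := (congrArg ℓ₂ (resω lWlm)).symm.trans hε₂
  replace hε₃ := (congrArg ℓ₃ (resω lWjm)).symm.trans hε₃
  /- ### Assembly -/
  have key : g₃ (show Γ(X.left, (U j).1 ⊓ (U l).1 ⊓ (U m).1) from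
        appLE (oX j l m) (𝟙 _) ((cotangentSheaf X).presheaf.map (homOfLE le_top).op ω)) -
      algebraMap k Γ(Y.left, (U' j).1 ⊓ (U' l).1 ⊓ (U' m).1) M *
        (show Γ(Y.left, (U' j).1 ⊓ (U' l).1 ⊓ (U' m).1) from
          appLE (oY j l m) (𝟙 _) ((cotangentSheaf Y).presheaf.map (homOfLE le_top).op ω')) =
      Y.left.presheaf.map (homOfLE lW'lm).op (ℓ l m ((cotangentSheaf X).presheaf.map (homOfLE le_top).op ω)) -
        Y.left.presheaf.map (homOfLE lW'jm).op (ℓ j m ((cotangentSheaf X).presheaf.map (homOfLE le_top).op ω)) +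
          Y.left.presheaf.map (homOfLE lW'jl).op (ℓ j l ((cotangentSheaf X).presheaf.map (homOfLE le_top).op ω)) := by
    -- (rewrite right-to-left only: matching `Ω¹`-valued patterns against `Ω¹`-sections is expensive)
    have s4 : ℓY ((cotangentSheaf X).presheaf.map (homOfLE le_top).op ω) +
        ℓ₁ ((cotangentSheaf X).presheaf.map (homOfLE le_top).op ω) +
        ℓ₂ ((cotangentSheaf X).presheaf.map (homOfLE le_top).op ω) -
        ℓ₃ ((cotangentSheaf X).presheaf.map (homOfLE le_top).op ω) =
        algebraMap k Γ(Y.left, (U' j).1 ⊓ (U' l).1 ⊓ (U' m).1) M *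
          (show Γ(Y.left, (U' j).1 ⊓ (U' l).1 ⊓ (U' m).1) from
            appLE (oY j l m) (𝟙 _) ((cotangentSheaf Y).presheaf.map (homOfLE le_top).op ω')) +
        Y.left.presheaf.map (homOfLE lW'jl).op (ℓ j l ((cotangentSheaf X).presheaf.map (homOfLE le_top).op ω)) +
        Y.left.presheaf.map (homOfLE lW'lm).op (ℓ l m ((cotangentSheaf X).presheaf.map (homOfLE le_top).op ω)) -
        Y.left.presheaf.map (homOfLE lW'jm).op (ℓ j m ((cotangentSheaf X).presheaf.map (homOfLE le_top).op ω)) := by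
      rw [← hY, ← hε₁, ← hε₂, ← hε₃]
    rw [E, s4]; ring
  -- `d¹` of `𝒪_Y` as a module is the structure-sheaf `d¹` (★ `cechMD1_unit`, definitional)
  rw [cechMD1_unit, cechD1_apply, Sections.res_apply, Sections.res_apply, Sections.res_apply]
  exact key

end Head

end Literature.AlgebraicGeometry.Deformation

end
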